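import Summits.Ventures.WeilGRH.TwistedRealWindowTest
import Mathlib.NumberTheory.Chebyshev
import HarnessLib

/-!
# GRH arm (rh-explicit, venture WeilGRH): the `cosh(x/2)` window — the asymptotically sharp trivial-key test

Cell `rh-explicit`, WEIL TRACK (structure seat weil-3, gen7) for the GRH ARM.  Instance of the real-window
inequality (`TwistedRealWindowTest.lean`) at the pole-aligned window `r(x) = cosh(x/2)𝟙_{[-a,a]}` (the profile that
maximises the `ζ` pole form `2|∫g cosh(x/2)|² − 2|∫g sinh(x/2)|²` relative to `‖g‖₂²`, Cauchy–Schwarz; the GRH arm's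
transfer constant `2(sinh a + a)` is `‖r‖₂²`-normalised `P(r)`).  Closed forms (`autocorr_coshWindow`,
`integral_sq_coshWindow`): for `0 ≤ t ≤ 2a`,

  `A_r(t) = ∫ r(x+t)r(x)dx = sinh(a − t/2) + (a − t/2) cosh(t/2)`,  `‖r‖₂² = A_r(0) = sinh a + a`.

Hence (`coshWindow_le_log_of_weilPositivityOnChar`) for every `χ` mod `q ≠ 1`, `a > 0`:

  `WeilPositivityOnChar χ a ⟹ 2Σ_{log n<2a} Λ(n)n^{-1/2} Re χ(n)·[sinh(a − ½log n) + (a − ½log n)cosh(½log n)]`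
      `+ K_κ(sinh a + a) − ∫₀^∞ ρ_κ(t) D_t(r) dt ≤ (sinh a + a)·log q`.

For the trivial key the normalised prime weight is `2Σ_{n<x}Λ(n)[(x/n − 1)/2 + (a − ½log n)(1 + 1/n)/2]/(sinh a + a)`
`= e^a(1 + o(1))` (vs `4e^a/a` for the flat window): numerically (HOME/rh-explicit-weil-3/coshwindow.py) the cosh
floor is `25.995` vs the transfer ceiling `26.036` at `a = 3` and `62.552` vs `62.580` at `a = 4` — the sufficient
condition `2(sinh a + a) ≤ log q` of `GeneralTransfer.lean` is asymptotically NECESSARY for the all-trivial key; at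
the data's windows (`a ≤ 1.3`) the flat window is the better of the two (`4.2913` vs `4.2883` at `a = 1`; certified
optimum `4.3058`).  RH/GRH-free; no definitions, no named facts.
-/

set_option autoImplicit false

noncomputable section

open Complex Filter Set MeasureTheory
open scoped Real Topology ComplexConjugate ContDiff ArithmeticFunction.vonMangoldt Chebyshev

namespace Summit.Ventures.WeilGRH

open Literature.NumberTheory.LFunctions
open Summit.RiemannHypothesis.RiemannHypothesis.Theorems.WeilFormatC

variable {q : ℕ} {a : ℝ}

/-! ## Hyperbolic bookkeeping -/

/-- `∫_c^d cosh = sinh d − sinh c`. -/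
theorem intervalIntegral_cosh (c d : ℝ) : ∫ x in c..d, Real.cosh x = Real.sinh d - Real.sinh c :=
  intervalIntegral.integral_eq_sub_of_hasDerivAt (fun x _ ↦ Real.hasDerivAt_sinh x)
    (Real.continuous_cosh.intervalIntegrable _ _)

/-- Product formula: `cosh((x+t)/2) cosh(x/2) = (cosh(x + t/2) + cosh(t/2))/2`. -/
theorem cosh_half_shift_mul_cosh_half (x t : ℝ) :
    Real.cosh ((x + t) / 2) * Real.cosh (x / 2) = (Real.cosh (x + t / 2) + Real.cosh (t / 2)) / 2 := by
  have h1 := Real.cosh_add ((x + t) / 2) (x / 2)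
  have h2 := Real.cosh_sub ((x + t) / 2) (x / 2)
  rw [show (x + t) / 2 + x / 2 = x + t / 2 by ring] at h1
  rw [show (x + t) / 2 - x / 2 = t / 2 by ring] at h2
  linarith

/-! ## The `cosh(x/2)` window -/

/-- The shifted product of the `cosh(x/2)` window is supported on `[-a, a − t]` (`t ≥ 0`). -/
theorem coshWindow_shift_mul {t : ℝ} (ht : 0 ≤ t) (x : ℝ) :
    (Icc (-a) a).indicator (fun y ↦ Real.cosh (y / 2)) (x + t) *
        (Icc (-a) a).indicator (fun y ↦ Real.cosh (y / 2)) x =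
      (Icc (-a) (a - t)).indicator (fun y ↦ Real.cosh ((y + t) / 2) * Real.cosh (y / 2)) x := by
  by_cases hx : x ∈ Icc (-a) (a - t)
  · have hx1 : x ∈ Icc (-a) a := ⟨hx.1, by linarith [hx.2]⟩
    have hx2 : x + t ∈ Icc (-a) a := ⟨by linarith [hx.1], by linarith [hx.2]⟩
    rw [indicator_of_mem hx2, indicator_of_mem hx1, indicator_of_mem hx]
  · rw [indicator_of_notMem hx]
    by_cases hx1 : x ∈ Icc (-a) a
    · have hx2 : x + t ∉ Icc (-a) a := fun h ↦ hx ⟨hx1.1, by linarith [h.2]⟩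
      rw [indicator_of_notMem hx2, zero_mul]
    · rw [indicator_of_notMem hx1, mul_zero]

/-- **Autocorrelation of the `cosh(x/2)` window**: for `0 ≤ t ≤ 2a`,
`∫ r(x+t) r(x) dx = sinh(a − t/2) + (a − t/2)cosh(t/2)`, `r = cosh(x/2)𝟙_{[-a,a]}`. -/
theorem autocorr_coshWindow {t : ℝ} (ht0 : 0 ≤ t) (ht : t ≤ 2 * a) :
    ∫ x, (Icc (-a) a).indicator (fun y ↦ Real.cosh (y / 2)) (x + t) *
        (Icc (-a) a).indicator (fun y ↦ Real.cosh (y / 2)) x =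
      Real.sinh (a - t / 2) + (a - t / 2) * Real.cosh (t / 2) := by
  simp_rw [coshWindow_shift_mul ht0]
  rw [integral_indicator measurableSet_Icc, integral_Icc_eq_integral_Ioc,
    ← intervalIntegral.integral_of_le (by linarith : -a ≤ a - t)]
  simp_rw [cosh_half_shift_mul_cosh_half]
  have hi1 : IntervalIntegrable (fun x : ℝ ↦ Real.cosh (x + t / 2)) volume (-a) (a - t) :=
    Continuous.intervalIntegrable (by fun_prop) _ _
  have hi2 : IntervalIntegrable (fun _ : ℝ ↦ Real.cosh (t / 2)) volume (-a) (a - t) :=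
    continuous_const.intervalIntegrable _ _
  have h1 : ∫ x in (-a)..(a - t), Real.cosh (x + t / 2) = 2 * Real.sinh (a - t / 2) := by
    rw [intervalIntegral.integral_comp_add_right Real.cosh, intervalIntegral_cosh,
      show a - t + t / 2 = a - t / 2 by ring, show -a + t / 2 = -(a - t / 2) by ring, Real.sinh_neg]
    ring
  have h2 : ∫ _ in (-a)..(a - t), Real.cosh (t / 2) = (2 * a - t) * Real.cosh (t / 2) := by
    rw [intervalIntegral.integral_const, smul_eq_mul]; ring
  rw [intervalIntegral.integral_div, intervalIntegral.integral_add hi1 hi2, h1, h2]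
  ring

/-- **`‖r‖₂² = sinh a + a`** for the `cosh(x/2)` window (`a ≥ 0`; the case `t = 0` of the autocorrelation). -/
theorem integral_sq_coshWindow (ha : 0 ≤ a) :
    ∫ x, ‖(((Icc (-a) a).indicator (fun y ↦ Real.cosh (y / 2)) x : ℝ) : ℂ)‖ ^ 2 = Real.sinh a + a := by
  have h := autocorr_coshWindow (a := a) le_rfl (by linarith)
  simp only [add_zero, zero_div, sub_zero, Real.cosh_zero, mul_one] at h
  rw [← h]
  refine integral_congr_ae (Eventually.of_forall fun x ↦ ?_)
  simp only [Complex.norm_real, Real.norm_eq_abs, sq]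
  exact abs_mul_abs_self _

/-- The `cosh(x/2)` window is a real window function: measurable, `0` off `[-a,a]`, `|r| ≤ cosh(a/2)`,
Lipschitz with constant `sinh(a/2)/2` on the closed window (`a ≥ 0`). -/
theorem coshWindow_window (ha : 0 ≤ a) :
    Measurable ((Icc (-a) a).indicator fun y ↦ Real.cosh (y / 2)) ∧
      (∀ x, x ∉ Icc (-a) a → (Icc (-a) a).indicator (fun y ↦ Real.cosh (y / 2)) x = 0) ∧
      (∀ x, |(Icc (-a) a).indicator (fun y ↦ Real.cosh (y / 2)) x| ≤ Real.cosh (a / 2)) ∧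
      ∀ x y, x ∈ Icc (-a) a → y ∈ Icc (-a) a →
        |(Icc (-a) a).indicator (fun y ↦ Real.cosh (y / 2)) y - (Icc (-a) a).indicator (fun y ↦ Real.cosh (y / 2)) x| ≤
          Real.sinh (a / 2) / 2 * |y - x| := by
  have hcont : Continuous fun y : ℝ ↦ Real.cosh (y / 2) := Real.continuous_cosh.comp (continuous_id.div_const 2)
  refine ⟨hcont.measurable.indicator measurableSet_Icc, fun x hx ↦ indicator_of_notMem hx _, fun x ↦ ?_,
    fun x y hx hy ↦ ?_⟩
  · by_cases hx : x ∈ Icc (-a) a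
    · rw [indicator_of_mem hx, abs_of_pos (Real.cosh_pos _), Real.cosh_le_cosh, abs_div, abs_div, abs_two,
        abs_of_nonneg ha]
      exact div_le_div_of_nonneg_right (abs_le.2 ⟨hx.1, hx.2⟩) zero_le_two
    · rw [indicator_of_notMem hx, abs_zero]; exact (Real.cosh_pos _).le
  · rw [indicator_of_mem hx, indicator_of_mem hy]
    -- mean value on the convex window: `|d/dy cosh(y/2)| = |sinh(y/2)|/2 ≤ sinh(a/2)/2`
    have hderiv : ∀ z, HasDerivAt (fun y : ℝ ↦ Real.cosh (y / 2)) (Real.sinh (z / 2) / 2) z := by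
      intro z
      have h := ((hasDerivAt_id z).div_const 2).cosh
      simp only [id] at h
      convert h using 1
      ring
    have hbound : ∀ z ∈ Icc (-a) a, ‖deriv (fun y : ℝ ↦ Real.cosh (y / 2)) z‖ ≤ Real.sinh (a / 2) / 2 := by
      intro z hz
      rw [(hderiv z).deriv, Real.norm_eq_abs, abs_div, abs_two, Real.abs_sinh,
        div_le_div_iff_of_pos_right two_pos, Real.sinh_le_sinh, abs_div, abs_two]
      exact div_le_div_of_nonneg_right (abs_le.2 ⟨hz.1, hz.2⟩) zero_le_two
    have h := (convex_Icc (-a) a).norm_image_sub_le_of_norm_deriv_le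
      (fun z _ ↦ (hderiv z).differentiableAt) hbound hx hy
    simpa only [Real.norm_eq_abs] using h

/-! ## The `cosh(x/2)`-window inequality -/

/-- **THE `cosh(x/2)`-WINDOW INEQUALITY.**  For every Dirichlet character `χ` mod `q ≠ 1` and `a > 0`: if
`WeilPositivityOnChar χ a` then, with `r = cosh(x/2)𝟙_{[-a,a]}`,

  `2Σ_{log n<2a} Λ(n)n^{-1/2} Re χ(n)·[sinh(a − ½log n) + (a − ½log n) cosh(½log n)] + K_κ·(sinh a + a)`
    `− ∫₀^∞ ρ_κ(t) D_t(r) dt ≤ (sinh a + a)·log q`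

(`K_κ = log 4π + γ + 2∫₀^∞(e^{(1/2−κ)t} − 1)dt/(2 sinh t)`; `D_t(r) = 2(sinh a + a) − 2[sinh(a − t/2) + (a − t/2)cosh(t/2)]`
on `[0, 2a]`, `= 2(sinh a + a)` beyond).  The pole-aligned profile: its trivial-key prime weight is `e^a(1 + o(1))`
per unit `‖r‖₂²`, the rate of the transfer constant `2(sinh a + a)`.  RH/GRH-free. -/
theorem coshWindow_le_log_of_weilPositivityOnChar (hq : q ≠ 1) (χ : DirichletCharacter ℂ q) (ha : 0 < a)
    (hW : WeilPositivityOnChar χ a) :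
    2 * (∑ n ∈ weilPrimeIndex a, (Λ n : ℝ) / Real.sqrt n *
          ((χ (n : ZMod q)).re *
            (Real.sinh (a - Real.log n / 2) + (a - Real.log n / 2) * Real.cosh (Real.log n / 2)))) +
        (Real.log (4 * π) + Real.eulerMascheroniConstant +
          2 * ∫ t in Ioi (0 : ℝ), weilKillingDensityPar (charParity χ) t) * (Real.sinh a + a) -
        ∫ t in Ioi (0 : ℝ), weilArchDensityPar (charParity χ) t *
          weilIncrement (fun x ↦ (((Icc (-a) a).indicator (fun y ↦ Real.cosh (y / 2)) x : ℝ) : ℂ)) t ≤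
      Real.log q * (Real.sinh a + a) := by
  obtain ⟨hm, hz, hb, hL⟩ := coshWindow_window ha.le
  have hf : ContDiff ℝ ∞ (fun x : ℝ ↦ ((Real.cosh (x / 2) : ℝ) : ℂ)) :=
    Complex.ofRealCLM.contDiff.comp (Real.contDiff_cosh.comp (contDiff_id.div_const 2))
  have hrf : ∀ x ∈ Icc (-a) a,
      (((Icc (-a) a).indicator (fun y ↦ Real.cosh (y / 2)) x : ℝ) : ℂ) = ((Real.cosh (x / 2) : ℝ) : ℂ) :=
    fun x hx ↦ by rw [indicator_of_mem hx]
  have h := realWindow_le_log_of_weilPositivityOnChar hq χ ha hW hm hz hb hL hf hrf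
  rw [integral_sq_coshWindow ha.le] at h
  have hA : ∀ n ∈ weilPrimeIndex a,
      ∫ x, (Icc (-a) a).indicator (fun y ↦ Real.cosh (y / 2)) (x + Real.log n) *
          (Icc (-a) a).indicator (fun y ↦ Real.cosh (y / 2)) x =
        Real.sinh (a - Real.log n / 2) + (a - Real.log n / 2) * Real.cosh (Real.log n / 2) := by
    intro n hn
    exact autocorr_coshWindow (Real.log_natCast_nonneg n) (mem_weilPrimeIndex.1 hn).le
  rw [Finset.sum_congr rfl fun n hn ↦ by rw [hA n hn]] at h
  exact h

/-- **Under `GRH(χ)`** (`χ` primitive mod `q ≠ 1`): the `cosh(x/2)`-window inequality at every `a > 0`. -/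
theorem coshWindow_le_log_of_grh [NeZero q] (hq : q ≠ 1) {χ : DirichletCharacter ℂ q}
    (hprim : χ.IsPrimitive) (hGRH : χ.RiemannHypothesis) (ha : 0 < a) :
    2 * (∑ n ∈ weilPrimeIndex a, (Λ n : ℝ) / Real.sqrt n *
          ((χ (n : ZMod q)).re *
            (Real.sinh (a - Real.log n / 2) + (a - Real.log n / 2) * Real.cosh (Real.log n / 2)))) +
        (Real.log (4 * π) + Real.eulerMascheroniConstant +
          2 * ∫ t in Ioi (0 : ℝ), weilKillingDensityPar (charParity χ) t) * (Real.sinh a + a) -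
        ∫ t in Ioi (0 : ℝ), weilArchDensityPar (charParity χ) t *
          weilIncrement (fun x ↦ (((Icc (-a) a).indicator (fun y ↦ Real.cosh (y / 2)) x : ℝ) : ℂ)) t ≤
      Real.log q * (Real.sinh a + a) :=
  coshWindow_le_log_of_weilPositivityOnChar hq χ ha ((WeilPositivityChar.of_grh hq hprim hGRH).on a)

/-! ## The trivial-key prime weight of the `cosh(x/2)` window is of order `e^{2a}` -/

/-- Each cosh weight dominates the log weight: for `log n < 2a`,
`Λ(n)n^{-1/2}[sinh(a − ½log n) + (a − ½log n)cosh(½log n)] ≥ Λ(n)(a − ½log n)/2`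
(`sinh ≥ 0` on `[0, ∞)`, `cosh(½log n) ≥ √n/2`). -/
theorem coshWeight_ge {n : ℕ} (hn : n ∈ weilPrimeIndex a) :
    (Λ n : ℝ) * (a - Real.log n / 2) / 2 ≤
      (Λ n : ℝ) / Real.sqrt n *
        (Real.sinh (a - Real.log n / 2) + (a - Real.log n / 2) * Real.cosh (Real.log n / 2)) := by
  have hlog : Real.log n < 2 * a := mem_weilPrimeIndex.1 hn
  have hΛ : 0 ≤ (Λ n : ℝ) := ArithmeticFunction.vonMangoldt_nonneg
  have hw : 0 ≤ a - Real.log n / 2 := by linarith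
  rcases Nat.eq_zero_or_pos n with rfl | hnpos
  · simp
  have hn0 : (0 : ℝ) < n := by exact_mod_cast hnpos
  have hsq : 0 < Real.sqrt n := Real.sqrt_pos.2 hn0
  have hsinh : 0 ≤ Real.sinh (a - Real.log n / 2) := Real.sinh_nonneg_iff.2 hw
  -- `cosh(½ log n) ≥ e^{½ log n}/2 = √n/2`
  have hcosh : Real.sqrt n / 2 ≤ Real.cosh (Real.log n / 2) := by
    rw [Real.cosh_eq, Real.sqrt_eq_rpow, Real.rpow_def_of_pos hn0,
      show Real.log n * (1 / 2 : ℝ) = Real.log n / 2 by ring]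
    have := Real.exp_pos (-(Real.log n / 2))
    linarith
  have key : (a - Real.log n / 2) / 2 ≤
      (Real.sinh (a - Real.log n / 2) + (a - Real.log n / 2) * Real.cosh (Real.log n / 2)) / Real.sqrt n := by
    rw [le_div_iff₀ hsq]
    nlinarith [mul_le_mul_of_nonneg_left hcosh hw]
  calc (Λ n : ℝ) * (a - Real.log n / 2) / 2 = (Λ n : ℝ) * ((a - Real.log n / 2) / 2) := by ring
    _ ≤ (Λ n : ℝ) * ((Real.sinh (a - Real.log n / 2) + (a - Real.log n / 2) * Real.cosh (Real.log n / 2)) /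
          Real.sqrt n) := mul_le_mul_of_nonneg_left key hΛ
    _ = _ := by ring

/-- **The trivial-key prime weight of the `cosh` window dominates `ψ(e^{2a−1})/2`**: the prime powers
`n ≤ e^{2a−1}` have log weight `a − ½log n ≥ ½`, so
`2Σ_{log n<2a} Λ(n)n^{-1/2}[sinh(a − ½log n) + (a − ½log n)cosh(½log n)] ≥ ψ(e^{2a−1})/2 ≥ ((e^{2a−1} − 1)log 2 − log(e^{2a−1} + 2))/2`
(Mathlib's Chebyshev bound) — order `e^{2a}`, against `‖r‖₂² = sinh a + a ≍ e^a`: the `e^a` rate of the transfer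
constant `2(sinh a + a)`. -/
theorem psi_le_coshWindow_primeSum (a : ℝ) :
    ((Real.exp (2 * a - 1) - 1) * Real.log 2 - Real.log (Real.exp (2 * a - 1) + 2)) / 2 ≤
      2 * ∑ n ∈ weilPrimeIndex a, (Λ n : ℝ) / Real.sqrt n *
        (Real.sinh (a - Real.log n / 2) + (a - Real.log n / 2) * Real.cosh (Real.log n / 2)) := by
  set X : ℝ := Real.exp (2 * a - 1) with hX
  have hX0 : 0 < X := Real.exp_pos _
  have hpsi := Chebyshev.psi_ge' (x := X) hX0.le
  have hsub : Finset.Ioc 0 ⌊X⌋₊ ⊆ weilPrimeIndex a := by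
    intro n hn
    rw [Finset.mem_Ioc] at hn
    rw [mem_weilPrimeIndex]
    have hn1 : (0 : ℝ) < n := by exact_mod_cast hn.1
    calc Real.log n ≤ Real.log X := Real.log_le_log hn1 ((Nat.cast_le.2 hn.2).trans (Nat.floor_le hX0.le))
      _ = 2 * a - 1 := Real.log_exp _
      _ < 2 * a := by linarith
  have hterm : ∀ n ∈ Finset.Ioc 0 ⌊X⌋₊, (Λ n : ℝ) / 4 ≤ (Λ n : ℝ) / Real.sqrt n *
      (Real.sinh (a - Real.log n / 2) + (a - Real.log n / 2) * Real.cosh (Real.log n / 2)) := by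
    intro n hn
    have hn' := hsub hn
    rw [Finset.mem_Ioc] at hn
    have hn1 : (0 : ℝ) < n := by exact_mod_cast hn.1
    have hlog : Real.log n ≤ 2 * a - 1 := by
      calc Real.log n ≤ Real.log X := Real.log_le_log hn1 ((Nat.cast_le.2 hn.2).trans (Nat.floor_le hX0.le))
        _ = 2 * a - 1 := Real.log_exp _
    have hΛ : 0 ≤ (Λ n : ℝ) := ArithmeticFunction.vonMangoldt_nonneg
    calc (Λ n : ℝ) / 4 ≤ (Λ n : ℝ) * (a - Real.log n / 2) / 2 := by
          rw [div_le_div_iff₀ (by norm_num) (by norm_num)]; nlinarith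
      _ ≤ _ := coshWeight_ge hn'
  have hmono : ∑ n ∈ Finset.Ioc 0 ⌊X⌋₊, (Λ n : ℝ) / Real.sqrt n *
        (Real.sinh (a - Real.log n / 2) + (a - Real.log n / 2) * Real.cosh (Real.log n / 2)) ≤
      ∑ n ∈ weilPrimeIndex a, (Λ n : ℝ) / Real.sqrt n *
        (Real.sinh (a - Real.log n / 2) + (a - Real.log n / 2) * Real.cosh (Real.log n / 2)) := by
    refine Finset.sum_le_sum_of_subset_of_nonneg hsub fun n hn _ ↦ ?_
    have hw : 0 ≤ a - Real.log n / 2 := by linarith [mem_weilPrimeIndex.1 hn]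
    exact le_trans (div_nonneg (mul_nonneg ArithmeticFunction.vonMangoldt_nonneg hw) zero_le_two)
      (coshWeight_ge hn)
  have hstep : ∑ n ∈ Finset.Ioc 0 ⌊X⌋₊, (Λ n : ℝ) / 4 ≤ ∑ n ∈ Finset.Ioc 0 ⌊X⌋₊, (Λ n : ℝ) / Real.sqrt n *
      (Real.sinh (a - Real.log n / 2) + (a - Real.log n / 2) * Real.cosh (Real.log n / 2)) :=
    Finset.sum_le_sum hterm
  have hpsi4 : ψ X / 2 = 2 * ∑ n ∈ Finset.Ioc 0 ⌊X⌋₊, (Λ n : ℝ) / 4 := by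
    rw [Chebyshev.psi, ← Finset.sum_div]; ring
  linarith

end Summit.Ventures.WeilGRH

end
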